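import Literature.MathematicalPhysics.QuantumFieldTheory.Balaban1983to89.Node00.Record13SepCoPHChi
import Literature.MathematicalPhysics.QuantumFieldTheory.Balaban1983to89.Node00.Record13LiveSelectorChi
import Literature.MathematicalPhysics.QuantumFieldTheory.Balaban1983to89.Node00.Record12MeasurabilityAbsolute

/-!
# BalabanUVNodes ∕ N12 → K1ᴬ — THE STAGE-13 H-TUPLE ON THE LIVE RE-PIN: `Provisos₁₃SepCoPHAx`, `Admissible`, `ZhUnity`, `SlotsNondegenerate₁₃Ax` (and K0b's residuals)
# TRANSPORTED from `(θ, h)` to `θᴸ := ⟨⟨θ.toStage13Params.liveRepin₁₃Ax F N, θ.Zr⟩, θ.Zh, θ.Phih⟩` — so that a rung-1 witness of the registered K1ᴬ skeleton v11.1 can be BUILT ON THE RE-PIN,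
# where N12's pin row `hsel : θ.toStage13Params.ppSel = ppSelLiveOfRecord …` is `rfl` (dag-lead g41 WORDS 654 (1)∕(2), `K1AX-V11-LINE-TABLE` v4.2 θ-OF-RECORD column)

Cell `pub-ymgap` (HUMAN RULING D-0062), seat `pub-ymgap-dag-n12-d` g37 (R134 N12 [B15] s2 «knit at the record»); helper of K1ᴬ `stmt-QuantumFields-27239` (DECIDING), `--kind proof
--supports … --as helper`, count-neutral.  WORDS 654 (2) HANDS: «the one untyped NODE 00 lemma `Provisos₁₃SepCoPHAx.liveRepin_of_hasResiduals` … custody node00-def-Y g35 (pen on M1 files)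
⇒ dag-n12-d g37 TYPES IT SUMMITS-SIDE, no Literature∕Node00 edit; def-Y may lift it by name later».  THEOREMS ONLY (0 `def`, 0 `instance`, 0 `sorry`); the tuple `θᴸ` is written as the
explicit anonymous constructor everywhere (the shape of every NODE 00 `N24_…_pointed_liveRepin₁₃` world: `⟨⟨θ.liveRepin₁₃ F N, Zr⟩, Zh, Phih⟩`).

WHAT IS HERE.
* §0 faces of `θᴸ` (`rfl`): `toStage13Params_liveRepinH` · `ppSel_liveRepinH` (THE ROW N12 ASKS — `θᴸ`'s `p–p′` selector IS the live one, so ✓p812749 §4's `hsel` is `rfl` at `θᴸ`) ·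
  `chiβOfRecord₁₃Ax_liveRepinH` · `gOfRecord₁₃Ax_liveRepinH`.
* §1 ★ `provisos₁₃SepCoPHAx_liveRepinH_of_zeta_nonneg` — `h : θ.Provisos₁₃SepCoPHAx F N` + `0 ≤ θ.ζ` pointwise ⟹ `θᴸ.Provisos₁₃SepCoPHAx F N`: the selector-blind rows (`measω measChi
  zetaUnity zetaAbs rzLaws zhLaws zhLocal hM hM₁ bg zetaMeas`) ARE `h`'s (histories, normalisations, settings, supports, backgrounds of record do not read `ppSel` — node00-def-Y's
  `…_liveRepin₁₃Chi` `rfl` faces); the two selector-reading rows `intPiece` ∕ `rstep` are node00-def-Y's `Stage13Params.intPiece₁₃_of_localBg_chi` (ANY selector) ∕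
  `Stage13Params.rstep₁₃_of_localBg_liveSel_chi` (AT THE LIVE selector, `hsel := rfl`) from (H-U) = node00-def-K0c's THEOREM `localBgMeasurable`, `h.zetaMeas`, `h.zetaAbs`, `0 ≤ ζ` — the
  verbatim recipe of def-Y's `provisos₁₃_liveRepin₁₃_of_localBg_chi` (`Record13LiveSelectorChi` :295) lifted to the H edition.  ★ `…_of_hasResiduals`: `0 ≤ ζ` from K0b's residuals
  (`hres.zeta_eq` + `zeta316OfRecord_nonneg`).
* §2 the companions at `θᴸ` BY NAME: `admissible_liveRepinH` (selector-blind), `zhUnity_liveRepinH_iff` (`Iff.rfl`: `Zh` unchanged), `hasResidualsOfRecord_liveRepinH`,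
  `slotsNondegenerate₁₃Ax_liveRepinH_of_hasResiduals` (def-Y's `slotsNondegenerate₁₃Ax_liveRepin₁₃Ax_of_hasResiduals`) — together: ★★ `inhabited13_shape_liveRepinH_of_hasResiduals`,
  «from `(θ, h)` admissible with print's partition of unity AND K0b's residuals, the `Inhabited13`-shaped conjunction AT `θᴸ`» (the registered rung-0 text
  `∃ θ, Provisos₁₃SepCoPHAx ∧ (ZhUnity ∧ SlotsNondegenerate₁₃Ax) ∧ Admissible`, v11.1 :209, UNFOLDED — the skeleton's defs are not tree names; dag-n24-c's mirror `K1AxV11Defs.Inhabited13`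
  reads it by `Iff.rfl` once landed).
NOT HERE: the world, `RecordSⱽ`, the revision `v`, the other nodes (the assembler's); nothing about the datum presented by `θᴸ` versus `θ` (the rung binds SOME θ).

HONEST FRAMING.  Bookkeeping transport over NODE 00's landed χ rows; nothing of Bałaban asserted; no NODE 00 file edited; `SlotsNondegenerate₁₃Ax` at `θᴸ` and `0 ≤ ζ` come from K0b's
RESIDUALS (`HasResidualsOfRecord` — a theorem at every θ-family witness, a hypothesis here); N12 NOT discharged; `stub_nodes13PWSVW` NOT closed; K0ᴬ ∕ K1ᴬ ∕ K3ᴬ OPEN (K1ᴬ 0∕6); counts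
unmoved (discharged 8∕27 · K 1∕4); one finite 𝕋⁴ programme at fixed `ε = L^{-K}` — NOT continuum ∕ ℝ⁴ ∕ OS; NOT the Yang–Mills mass gap (Clay).
Sources (bookkeeping only): [Balaban1988Convergent] (2.18) p.257, (3.2)–(3.9) pp.265–266, (3.16) p.268, (3.22) p.269, (3.24)–(3.25) p.270 (the live `p–p′` selector and the rows it reads);
[Balaban1989LargeFieldI] (0.3)–(0.4) p.176; [Balaban1987RG1] (2.9) p.266 with (2.3) p.265 (the re-centred cut-off), (0.21) p.256.
-/

noncomputable section

namespace Summit.QuantumFields.YangMills.BalabanUVNodes.N12Stage13HProvisosSepCoPHAxAtLiveRepin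

open Literature.MathematicalPhysics.QuantumFieldTheory.Balaban1983to89
open Literature.MathematicalPhysics.QuantumFieldTheory.Balaban1983to89.T4Continuum (T4Family)
open Literature.MathematicalPhysics.QuantumFieldTheory.Balaban1983to89.Node00

variable {F : T4Family} {N : ℕ} [NeZero N]

/-! ## §0  Faces of the H-tuple on the re-pin (`rfl`) -/

section Faces

variable (θ : Stage13HParams F N)

/-- The Stage-13 part of the re-pinned H-tuple IS the re-centred live re-pin (`rfl`). [cite: Balaban1988Convergent, (3.22) p.269 (bookkeeping)] -/
theorem toStage13Params_liveRepinH :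
    (⟨⟨θ.toStage13Params.liveRepin₁₃Ax F N, θ.Zr⟩, θ.Zh, θ.Phih⟩ : Stage13HParams F N).toStage13Params = θ.toStage13Params.liveRepin₁₃Ax F N := rfl

/-- **THE ROW N12 ASKS, AT THE RE-PINNED TUPLE, IS `rfl`**: its `p–p′` selector is the live selector of record along the re-centred normalisations.
[cite: Balaban1988Convergent, (3.22) p.269; Balaban1989LargeFieldI, (0.3) p.176 (bookkeeping)] -/
theorem ppSel_liveRepinH :
    (⟨⟨θ.toStage13Params.liveRepin₁₃Ax F N, θ.Zr⟩, θ.Zh, θ.Phih⟩ : Stage13HParams F N).toStage13Params.ppSel =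
      ppSelLiveOfRecord F N θ.ν θ.τ9 (EOfRecord₁₃Ax F N (⟨⟨θ.toStage13Params.liveRepin₁₃Ax F N, θ.Zr⟩, θ.Zh, θ.Phih⟩ : Stage13HParams F N).toStage13Params)
        (wOfRecord₉ F N (⟨⟨θ.toStage13Params.liveRepin₁₃Ax F N, θ.Zr⟩, θ.Zh, θ.Phih⟩ : Stage13HParams F N).toStage9Params) := rfl

/-- The re-centred cut-off of the re-pinned tuple IS `θ`'s (`rfl`; `chiβOfRecord₁₃Ax` reads `ν`, `ε₂₉`). [cite: Balaban1987RG1, (2.9) p.266 with (2.3) p.265 (bookkeeping)] -/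
theorem chiβOfRecord₁₃Ax_liveRepinH :
    chiβOfRecord₁₃Ax F N (⟨⟨θ.toStage13Params.liveRepin₁₃Ax F N, θ.Zr⟩, θ.Zh, θ.Phih⟩ : Stage13HParams F N).toStage13Params = chiβOfRecord₁₃Ax F N θ.toStage13Params := rfl

/-- The re-centred history of the re-pinned tuple IS `θ`'s (`rfl`; histories are selector-blind). [cite: Balaban1987RG1, (0.17)–(0.20) pp.255–256 (bookkeeping)] -/
theorem gOfRecord₁₃Ax_liveRepinH (p : B12.RunParams) :
    gOfRecord₁₃Ax F N (⟨⟨θ.toStage13Params.liveRepin₁₃Ax F N, θ.Zr⟩, θ.Zh, θ.Phih⟩ : Stage13HParams F N).toStage13Params p = gOfRecord₁₃Ax F N θ.toStage13Params p := rfl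

end Faces

/-! ## §1  `Provisos₁₃SepCoPHAx` transported to the re-pin -/

section Provisos

/-- ★ **THE SEPARATED-RANGE H-PROVISOS AT THE RE-PINNED TUPLE, from `h` and `0 ≤ ζ`**: selector-blind rows are `h`'s; `intPiece` ∕ `rstep` at the LIVE selector are node00-def-Y's
`intPiece₁₃_of_localBg_chi` ∕ `rstep₁₃_of_localBg_liveSel_chi` from (H-U) (K0c's theorem `localBgMeasurable`), `h.zetaMeas`, `h.zetaAbs`, `0 ≤ ζ`.
[cite: Balaban1988Convergent, (2.18) p.257, (3.16) p.268, (3.22) p.269, (3.24)–(3.25) p.270; Balaban1989LargeFieldI, (0.3)–(0.4) p.176 (bookkeeping transport)] -/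
theorem provisos₁₃SepCoPHAx_liveRepinH_of_zeta_nonneg (θ : Stage13HParams F N) (h : θ.Provisos₁₃SepCoPHAx F N)
    (hζ0 : ∀ p g k s Pl Ql RS U V', 0 ≤ θ.ζ p g k s Pl Ql RS U V') :
    (⟨⟨θ.toStage13Params.liveRepin₁₃Ax F N, θ.Zr⟩, θ.Zh, θ.Phih⟩ : Stage13HParams F N).Provisos₁₃SepCoPHAx F N :=
  { intPiece := (θ.toStage13Params.liveRepin₁₃Chi F N (chiβOfRecord₁₃Ax F N θ.toStage13Params)).intPiece₁₃_of_localBg_chi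
      (chiβOfRecord₁₃Ax F N θ.toStage13Params) (localBgMeasurable F N θ.ν) h.zetaMeas h.zetaAbs hζ0
    measω := h.measω
    measChi := h.measChi
    zetaUnity := h.zetaUnity
    zetaAbs := h.zetaAbs
    rstep := (θ.toStage13Params.liveRepin₁₃Chi F N (chiβOfRecord₁₃Ax F N θ.toStage13Params)).rstep₁₃_of_localBg_liveSel_chi
      (chiβOfRecord₁₃Ax F N θ.toStage13Params) rfl (localBgMeasurable F N θ.ν) h.zetaMeas h.zetaAbs hζ0
    rzLaws := h.rzLaws
    zhLaws := h.zhLaws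
    zhLocal := h.zhLocal
    hM := h.hM
    hM₁ := h.hM₁
    bg := h.bg
    zetaMeas := h.zetaMeas }

/-- ★ **… from `h` and K0b's RESIDUALS** (`0 ≤ ζ` by `hres.zeta_eq` + `zeta316OfRecord_nonneg`). [cite: Balaban1988Convergent, (3.16) p.268, (2.21) p.258, (3.20) p.269 (bookkeeping)] -/
theorem provisos₁₃SepCoPHAx_liveRepinH_of_hasResiduals (θ : Stage13HParams F N) (h : θ.Provisos₁₃SepCoPHAx F N) (hres : θ.toStage13Params.HasResidualsOfRecord F N) :
    (⟨⟨θ.toStage13Params.liveRepin₁₃Ax F N, θ.Zr⟩, θ.Zh, θ.Phih⟩ : Stage13HParams F N).Provisos₁₃SepCoPHAx F N :=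
  provisos₁₃SepCoPHAx_liveRepinH_of_zeta_nonneg θ h (by
    rw [hres.zeta_eq]; exact fun p g k s Pl Ql RS U V' => zeta316OfRecord_nonneg θ.A₁ p g k s Pl Ql RS U V')

end Provisos

/-! ## §2  The companions at the re-pinned tuple, and the `Inhabited13`-shaped conjunction there -/

section Companions

variable (θ : Stage13HParams F N)

/-- `Admissible` is selector-blind: it transports to the re-pinned tuple. [cite: Balaban1987RG1, (0.21) p.256 (bookkeeping)] -/
theorem admissible_liveRepinH (hθ : θ.Admissible F N) : (⟨⟨θ.toStage13Params.liveRepin₁₃Ax F N, θ.Zr⟩, θ.Zh, θ.Phih⟩ : Stage13HParams F N).Admissible F N := hθ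

/-- Print's partition of unity `ZhUnity` reads `Zh` only: at the re-pinned tuple it IS `θ`'s (`Iff.rfl`). [cite: Balaban1988Convergent, (3.16)–(3.20) pp.268–269 (bookkeeping)] -/
theorem zhUnity_liveRepinH_iff : (⟨⟨θ.toStage13Params.liveRepin₁₃Ax F N, θ.Zr⟩, θ.Zh, θ.Phih⟩ : Stage13HParams F N).ZhUnity F N ↔ θ.ZhUnity F N := Iff.rfl

/-- K0b's residuals are selector-blind: they transport to the re-pinned tuple. [cite: Balaban1988Convergent, (3.16) p.268, (2.21) p.258, (3.20) p.269 (bookkeeping)] -/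
theorem hasResidualsOfRecord_liveRepinH (hres : θ.toStage13Params.HasResidualsOfRecord F N) :
    (⟨⟨θ.toStage13Params.liveRepin₁₃Ax F N, θ.Zr⟩, θ.Zh, θ.Phih⟩ : Stage13HParams F N).toStage13Params.HasResidualsOfRecord F N :=
  ⟨hres.zeta_eq, hres.Rz_eq, hres.Zt_eq⟩

/-- **Row P12 at the re-pinned tuple OUTRIGHT from K0b's residuals** (node00-def-Y's `slotsNondegenerate₁₃Ax_liveRepin₁₃Ax_of_hasResiduals` BY NAME).
[cite: Balaban1988Convergent, (3.22) p.269, (3.24)–(3.25) p.270; Balaban1989LargeFieldI, (0.3)–(0.4) p.176 (bookkeeping)] -/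
theorem slotsNondegenerate₁₃Ax_liveRepinH_of_hasResiduals (hres : θ.toStage13Params.HasResidualsOfRecord F N) :
    (⟨⟨θ.toStage13Params.liveRepin₁₃Ax F N, θ.Zr⟩, θ.Zh, θ.Phih⟩ : Stage13HParams F N).toStage13Params.SlotsNondegenerate₁₃Ax F N :=
  Stage13Params.slotsNondegenerate₁₃Ax_liveRepin₁₃Ax_of_hasResiduals (θ := θ.toStage13Params) hres

/-- ★★ **THE `Inhabited13`-SHAPED CONJUNCTION AT THE RE-PINNED TUPLE** (registered rung-0 text v11.1 :209, unfolded): from `(θ, h)` admissible with print's partition of unity AND K0b's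
residuals, the tuple ON THE RE-PIN carries `Provisos₁₃SepCoPHAx ∧ (ZhUnity ∧ SlotsNondegenerate₁₃Ax) ∧ Admissible` — and its `p–p′` selector is the live one (`ppSel_liveRepinH`), so N12's
rung-1 pin row `hsel` is `rfl` there.  `θ`'s OWN `SlotsNondegenerate₁₃Ax` is not read (row P12 at the re-pin is outright).
[cite: Balaban1988Convergent, (2.18) p.257, (3.16)–(3.22) pp.268–269; Balaban1989LargeFieldI, (0.3)–(0.4) p.176; Balaban1987RG1, (0.21) p.256 (bookkeeping)] -/
theorem inhabited13_shape_liveRepinH_of_hasResiduals (h : θ.Provisos₁₃SepCoPHAx F N) (hZ : θ.ZhUnity F N) (hθ : θ.Admissible F N)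
    (hres : θ.toStage13Params.HasResidualsOfRecord F N) :
    (⟨⟨θ.toStage13Params.liveRepin₁₃Ax F N, θ.Zr⟩, θ.Zh, θ.Phih⟩ : Stage13HParams F N).Provisos₁₃SepCoPHAx F N ∧
      ((⟨⟨θ.toStage13Params.liveRepin₁₃Ax F N, θ.Zr⟩, θ.Zh, θ.Phih⟩ : Stage13HParams F N).ZhUnity F N ∧
        (⟨⟨θ.toStage13Params.liveRepin₁₃Ax F N, θ.Zr⟩, θ.Zh, θ.Phih⟩ : Stage13HParams F N).toStage13Params.SlotsNondegenerate₁₃Ax F N) ∧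
      (⟨⟨θ.toStage13Params.liveRepin₁₃Ax F N, θ.Zr⟩, θ.Zh, θ.Phih⟩ : Stage13HParams F N).Admissible F N :=
  ⟨provisos₁₃SepCoPHAx_liveRepinH_of_hasResiduals θ h hres,
    ⟨(zhUnity_liveRepinH_iff θ).2 hZ, slotsNondegenerate₁₃Ax_liveRepinH_of_hasResiduals θ hres⟩, admissible_liveRepinH θ hθ⟩

end Companions

end Summit.QuantumFields.YangMills.BalabanUVNodes.N12Stage13HProvisosSepCoPHAxAtLiveRepin

end
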